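import Literature.AlgebraicTopology.SingularHomology.HomotopyAdditionProofs
import Literature.AlgebraicTopology.SingularHomology.HomotopyAdditionHorn
import Literature.AlgebraicTopology.Homotopy.CubeHomotopyExtension
import HarnessLib

/-!
# The collapse and the radial homeomorphism give the same classes in degree `2`

Topic `Literature/AlgebraicTopology/SingularHomology`. The tree represents the element of
`πₙ(X, x₀)` carried by a singular simplex `g : (Δⁿ, ∂Δⁿ) → (X, x₀)` (E. H. Spanier, *Algebraic
Topology* (1981), Ch. 7 §4, p. 391: "choose a homeomorphism of `(Δⁿ, Δ̇ⁿ, v₀)` onto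
`(Iⁿ, İⁿ, z₀)` … `[α]`") through two different maps of pairs `(Iⁿ, ∂Iⁿ) → (Δⁿ, ∂Δⁿ)`:

* `simplexClass g hg = [g ∘ κₙ]` (`HurewiczSimplexClass.lean`), `κₙ = cubeSimplexHomeo n` the
  RADIAL homeomorphism of pairs (central projection from the barycentre,
  `Homotopy/SimplexBallHomeomorph.lean`) — the device behind the relative classes
  `relSimplexClass` of `RelativeSimplexClass.lean` and hence behind the relative Hurewicz files;
* `collapseClass g hg = [g ∘ cₙ]` (`HomotopyAdditionProofs.lean`), `cₙ = CubeCollapse.collapse`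
  the COLLAPSE `Iⁿ → Δⁿ` (faces onto faces, `CubeSimplexCollapse.lean`) — the device for which
  the homotopy addition theorem `∏ᵢ [τ ∘ δᵢ]^((-1)ⁱ) = 1` is proved
  (`prod_collapseClass_face_zpow_eq_one`).

This file PROVES that **in degree `2` the two devices agree**, `collapseClass g hg = simplexClass g hg`
(`collapseClass_eq_simplexClass`), by exhibiting a homotopy of maps of pairs
`(I², ∂I²) → (Δ², ∂Δ²)` from `c₂` to `κ₂` (`homotopicWith_collapse_cubeSimplexHomeo`):

1. on the boundary, read in the sup-norm disc `D² ≅ Δ²` (`SimplexBall.toBall`), the two loops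
   `∂I² → S¹` are `y ↦ toBall (c₂ y)` and `y ↦ 2y - 1`; the segment between them never passes
   through the centre (`seg_ne_zero`: four elementary edge cases — both loops run once around
   the triangle in the same sense, `v₀ → v₁ → v₂ → v₀`), so its sup-normalisation is a homotopy of
   the boundary loops inside `∂Δ²`;
2. the homotopy extension property of `(I², ∂I²)` (`CubeHEP.exists_extension_cube`,
   `Homotopy/CubeHomotopyExtension.lean`; Hatcher, *Algebraic Topology* (2002), Prop. 0.16) extends it
   to a homotopy of `c₂` ending at a map which agrees with `κ₂` on `∂I²`;
3. the straight segment in the convex `Δ²` joins that map to `κ₂` rel `∂I²`.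

Consequence (`prod_simplexClass_face_zpow_eq_one`, `simplexClass_face_mul_eq`): **the homotopy
addition theorem in degree `2` for the classes `simplexClass`** — for `τ : Δ³ → X` constant on
the `1`-skeleton, `[τ∘δ₀][τ∘δ₁]⁻¹[τ∘δ₂][τ∘δ₃]⁻¹ = 1`, i.e. `[τ∘δ₀][τ∘δ₂] = [τ∘δ₁][τ∘δ₃]` in
`π₂(X, x₀)` (Spanier 1981, Ch. 7 §5 Prop. 3, `B₂`, absolute form). This is the absolute input of
the proof of the relative statement `relHomotopyAddition_two` (`RelHomotopyAdditionTwoProofs.lean`).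
Everything here is proved; `[folklore]` geometry. Higher degrees are not treated (the same
segment argument would need the non-antipodality of `cₙ` and `κₙ` on `∂Iⁿ`, not checked here).

## References

* E. H. Spanier, *Algebraic Topology*, Springer (1981), Ch. 7 §4 p. 391, §5 Prop. 3. [Spanier1981]
* A. Hatcher, *Algebraic Topology*, CUP (2002), Prop. 0.16; §4.1 p. 340. [HatcherAT2002]
-/

noncomputable section

open Set Metric Function
open scoped unitInterval Topology

universe u

namespace Literature.AlgebraicTopology.SingularHomology

open CubeCollapse Literature.AlgebraicTopology.Homotopy Literature.AlgebraicTopology.Homotopy.SimplexBall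

namespace CollapseCompare

/-! ### The collapse `c₂ : I² → Δ²` and the chart of `Δ²` in coordinates -/

/-- `P₁(y) = y₀` on `I²`. [folklore] -/
lemma pp_one (y : Fin 2 → I) : pp y 1 = (y 0 : ℝ) := by
  rw [pp_succ y (show 0 < 2 by norm_num), pp_zero, one_mul, tval_of_lt y (show 0 < 2 by norm_num)]
  rfl

/-- `P₂(y) = y₀ y₁` on `I²`. [folklore] -/
lemma pp_two (y : Fin 2 → I) : pp y 2 = (y 0 : ℝ) * (y 1 : ℝ) := by
  rw [pp_succ y (show 1 < 2 by norm_num), pp_one, tval_of_lt y (show 1 < 2 by norm_num)]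
  rfl

/-- `c₂(y)₁ = y₀ - y₀ y₁`. [folklore] -/
lemma collapse_two_apply_one (y : Fin 2 → I) :
    ((collapse y : StdSimplex 2) : Fin 3 → ℝ) 1 = (y 0 : ℝ) - (y 0 : ℝ) * (y 1 : ℝ) := by
  rw [collapse_apply, Fin.val_one, pp_one, pp_two]

/-- `c₂(y)₂ = y₀ y₁`. [folklore] -/
lemma collapse_two_apply_two (y : Fin 2 → I) :
    ((collapse y : StdSimplex 2) : Fin 3 → ℝ) 2 = (y 0 : ℝ) * (y 1 : ℝ) := by
  rw [collapse_apply, Fin.val_two, pp_two, pp_of_lt y (show 2 < 2 + 1 by norm_num), sub_zero]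

/-- `c = 1/3` for `Δ²`. [folklore] -/
lemma c_two : c 2 = 1 / 3 := by
  unfold c; norm_num

/-- The chart of `Δ²` at the barycentre, coordinate `0`: `p₁ - 1/3`. [folklore] -/
lemma chart_two_apply_zero (p : Fin 3 → ℝ) : chart 2 p 0 = p 1 - 1 / 3 := by
  rw [← c_two]; rfl

/-- The chart of `Δ²` at the barycentre, coordinate `1`: `p₂ - 1/3`. [folklore] -/
lemma chart_two_apply_one (p : Fin 3 → ℝ) : chart 2 p 1 = p 2 - 1 / 3 := by
  rw [← c_two]; rfl

/-! ### The segment between the two boundary loops misses the centre -/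

/-- **The segment misses the centre.** In the sup-norm disc model of `Δ²` (`SimplexBall.toBall`),
the straight segment `(1 - t) · toBall(c₂ y) + t · (2y - 1)` from the collapse to the radial
homeomorphism (`κ₂ y = toBall⁻¹(2y - 1)`) does not pass through the centre when `y ∈ ∂I²`,
`t ∈ [0, 1]`: in the chart, `toBall (c₂ y)` is a positive multiple of `chart (c₂ y)`, and on each
of the four edges of the square the two linear equations "segment point `= 0`" are contradictory
(the two loops `∂I² → ∂Δ²` both run once around the triangle in the sense `v₀ → v₁ → v₂ → v₀` and
are never antipodal with respect to the barycentre). [folklore] -/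
theorem seg_ne_zero {t : ℝ} (ht0 : 0 ≤ t) (ht1 : t ≤ 1) {y : Fin 2 → I}
    (hy : y ∈ Cube.boundary (Fin 2)) :
    (1 - t) • ((toBall 2 (collapse y) : closedBall (0 : Fin 2 → ℝ) 1) : Fin 2 → ℝ) +
      t • cubeStretch 2 y ≠ 0 := by
  intro h0
  set p : StdSimplex 2 := collapse y with hpdef
  have hpb : p ∈ stdBoundary 2 := collapse_mem_stdBoundary hy
  set u : Fin 2 → ℝ := chart 2 (p : Fin 3 → ℝ) with hudef
  set r : ℝ := gauge (body 2) u / gauge (closedBall (0 : Fin 2 → ℝ) 1) u with hrdef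
  have hb : ((toBall 2 p : closedBall (0 : Fin 2 → ℝ) 1) : Fin 2 → ℝ) = r • u := rfl
  have hr0 : 0 ≤ r := div_nonneg (gauge_nonneg _) (gauge_nonneg _)
  have hsph : ‖r • u‖ = 1 := by
    rw [← hb, ← mem_sphere_zero_iff_norm]
    exact (toBall_mem_sphere_iff 2 p).2 hpb
  have hrpos : 0 < r := by
    rcases hr0.lt_or_eq with h | h
    · exact h
    · rw [← h, zero_smul, norm_zero] at hsph
      exact absurd hsph zero_ne_one
  -- the two coordinate equations
  have e : ∀ i, (1 - t) * (r * u i) + t * cubeStretch 2 y i = 0 := fun i => by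
    have h := congrFun h0 i
    rw [hb] at h
    simpa only [Pi.add_apply, Pi.smul_apply, smul_eq_mul, Pi.zero_apply] using h
  set s : ℝ := (1 - t) * r with hsdef
  have hs0 : 0 ≤ s := mul_nonneg (by linarith) hr0
  have hst : 0 < s + t := by
    rcases ht0.lt_or_eq with h | h
    · linarith
    · have : s = r := by rw [hsdef, ← h]; ring
      linarith
  have hu0 : u 0 = (p : Fin 3 → ℝ) 1 - 1 / 3 := chart_two_apply_zero _
  have hu1 : u 1 = (p : Fin 3 → ℝ) 2 - 1 / 3 := chart_two_apply_one _
  have hp1 : (p : Fin 3 → ℝ) 1 = (y 0 : ℝ) - (y 0 : ℝ) * (y 1 : ℝ) := collapse_two_apply_one y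
  have hp2 : (p : Fin 3 → ℝ) 2 = (y 0 : ℝ) * (y 1 : ℝ) := collapse_two_apply_two y
  have hw0 : cubeStretch 2 y 0 = 2 * (y 0 : ℝ) - 1 := rfl
  have hw1 : cubeStretch 2 y 1 = 2 * (y 1 : ℝ) - 1 := rfl
  have e0 : s * ((y 0 : ℝ) - (y 0 : ℝ) * (y 1 : ℝ) - 1 / 3) + t * (2 * (y 0 : ℝ) - 1) = 0 := by
    have h := e 0
    rw [hu0, hp1, hw0] at h
    rw [hsdef]
    linear_combination h
  have e1 : s * ((y 0 : ℝ) * (y 1 : ℝ) - 1 / 3) + t * (2 * (y 1 : ℝ) - 1) = 0 := by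
    have h := e 1
    rw [hu1, hp2, hw1] at h
    rw [hsdef]
    linear_combination h
  have hy0 := (y 0).2.1
  have hy0' := (y 0).2.2
  have hy1 := (y 1).2.1
  have hy1' := (y 1).2.2
  -- the four edges of the square
  have key : ∀ i : Fin 2, ¬ (y i = 0 ∨ y i = 1) := by
    rw [Fin.forall_fin_two]
    constructor
    · rintro (hi | hi)
      · -- the edge `y₀ = 0`: `c₂` is constant `= v₀` there
        have h : (y 0 : ℝ) = 0 := by rw [hi]; rfl
        rw [h] at e0
        have : s * (1 / 3) + t = 0 := by linear_combination -e0
        linarith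
      · -- the edge `y₀ = 1`
        have h : (y 0 : ℝ) = 1 := by rw [hi]; rfl
        rw [h] at e0 e1
        have ht' : t = s * ((y 1 : ℝ) - 2 / 3) := by linear_combination e0
        have key : s * (2 * ((y 1 : ℝ) - 1 / 3) ^ 2 + 1 / 9) = 0 := by
          rw [ht'] at e1
          linear_combination e1
        have hspos : 0 < s := by
          rcases hs0.lt_or_eq with h' | h'
          · exact h'
          · rw [← h'] at ht' hst
            simp only [zero_mul] at ht'
            linarith
        have : 0 < s * (2 * ((y 1 : ℝ) - 1 / 3) ^ 2 + 1 / 9) := mul_pos hspos (by positivity)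
        linarith
    · rintro (hi | hi)
      · -- the edge `y₁ = 0`
        have h : (y 1 : ℝ) = 0 := by rw [hi]; rfl
        rw [h] at e1
        have : s * (1 / 3) + t = 0 := by linear_combination -e1
        linarith
      · -- the edge `y₁ = 1`
        have h : (y 1 : ℝ) = 1 := by rw [hi]; rfl
        rw [h] at e0 e1
        have ht' : t = s * (1 / 3 - (y 0 : ℝ)) := by linear_combination e1
        have key : s * (2 * ((y 0 : ℝ) - 5 / 12) ^ 2 + 23 / 72) = 0 := by
          rw [ht'] at e0
          linear_combination -e0
        have hspos : 0 < s := by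
          rcases hs0.lt_or_eq with h' | h'
          · exact h'
          · rw [← h'] at ht' hst
            simp only [zero_mul] at ht'
            linarith
        have : 0 < s * (2 * ((y 0 : ℝ) - 5 / 12) ^ 2 + 23 / 72) := mul_pos hspos (by positivity)
        linarith
  obtain ⟨i, hi⟩ := hy
  exact key i hi

/-! ### Sup-normalisation -/

/-- `‖v/‖v‖‖ = 1` for `v ≠ 0`. [folklore] -/
lemma norm_inv_norm_smul_self {v : Fin 2 → ℝ} (hv : v ≠ 0) : ‖‖v‖⁻¹ • v‖ = 1 := by
  rw [norm_smul, norm_inv, norm_norm, inv_mul_cancel₀ (norm_ne_zero_iff.2 hv)]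

/-- `v ↦ v/‖v‖` is continuous off `0`. [folklore] -/
lemma continuousOn_inv_norm_smul : ContinuousOn (fun v : Fin 2 → ℝ => ‖v‖⁻¹ • v) {v | v ≠ 0} :=
  (continuousOn_id.norm.inv₀ fun _ hv => norm_ne_zero_iff.2 hv).smul continuousOn_id

/-! ### The homotopy of pairs from the collapse to the radial homeomorphism -/

/-- **A homotopy of maps of pairs `(I², ∂I²) → (Δ², ∂Δ²)` from the collapse `c₂` to the radial
homeomorphism `κ₂`**: the sup-normalised segment `K(t, y) = toBall⁻¹(V/‖V‖)`,
`V = (1 - t)·toBall(c₂ y) + t·(2y - 1)` (`seg_ne_zero`), is a homotopy inside `∂Δ²` of the two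
boundary loops; it is extended over `I²` by the homotopy extension property of `(I², ∂I²)`
(`CubeHEP.exists_extension_cube`; Hatcher 2002, Prop. 0.16), and the end of the extension is joined
to `κ₂` by the straight segment in `Δ²`, rel `∂I²`. [folklore] -/
theorem homotopicWith_collapse_cubeSimplexHomeo :
    (cubeCollapse 2).HomotopicWith (cubeToSimplex 2)
      (fun f => ∀ y ∈ Cube.boundary (Fin 2), f y ∈ stdBoundary 2) := by
  -- the segment `V` and the boundary homotopy `K`
  let V : I × (Fin 2 → I) → (Fin 2 → ℝ) := fun q =>
    (1 - (q.1 : ℝ)) • ((toBall 2 (collapse q.2) : closedBall (0 : Fin 2 → ℝ) 1) : Fin 2 → ℝ) +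
      (q.1 : ℝ) • cubeStretch 2 q.2
  let K : I × (Fin 2 → I) → StdSimplex 2 := fun q =>
    (toBall 2).symm ⟨‖V q‖⁻¹ • V q, inv_norm_smul_mem_unitClosedBall _⟩
  have hVc : Continuous V := by
    refine ((continuous_const.sub (continuous_subtype_val.comp continuous_fst)).smul ?_).add
      ((continuous_subtype_val.comp continuous_fst).smul ((continuous_cubeStretch 2).comp continuous_snd))
    exact continuous_subtype_val.comp ((toBall 2).continuous.comp (continuous_collapse.comp continuous_snd))
  have hVne : ∀ (t : I), ∀ y ∈ Cube.boundary (Fin 2), V (t, y) ≠ 0 := fun t y hy =>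
    seg_ne_zero t.2.1 t.2.2 hy
  have hKc : ContinuousOn K ((univ : Set I) ×ˢ Cube.boundary (Fin 2)) := by
    have h1 : ContinuousOn (fun q => ‖V q‖⁻¹ • V q) ((univ : Set I) ×ˢ Cube.boundary (Fin 2)) :=
      continuousOn_inv_norm_smul.comp hVc.continuousOn (by rintro ⟨t, y⟩ ⟨-, hy⟩; exact hVne t y hy)
    have h2 : ContinuousOn (fun q => (⟨‖V q‖⁻¹ • V q, inv_norm_smul_mem_unitClosedBall _⟩ :
        closedBall (0 : Fin 2 → ℝ) 1)) ((univ : Set I) ×ˢ Cube.boundary (Fin 2)) := by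
      rw [Topology.IsInducing.subtypeVal.continuousOn_iff]
      exact h1
    exact (toBall 2).symm.continuous.comp_continuousOn h2
  have hKb : ∀ (t : I), ∀ y ∈ Cube.boundary (Fin 2), K (t, y) ∈ stdBoundary 2 := fun t y hy =>
    (exists_toBall_symm_apply_eq_zero_iff 2 _).2
      (mem_sphere_zero_iff_norm.2 (norm_inv_norm_smul_self (hVne t y hy)))
  have hK0 : ∀ y ∈ Cube.boundary (Fin 2), K (0, y) = collapse y := by
    intro y hy
    have h1 : ‖((toBall 2 (collapse y) : closedBall (0 : Fin 2 → ℝ) 1) : Fin 2 → ℝ)‖ = 1 :=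
      mem_sphere_zero_iff_norm.1 ((toBall_mem_sphere_iff 2 _).2 (collapse_mem_stdBoundary hy))
    have hV0 : V (0, y) = ((toBall 2 (collapse y) : closedBall (0 : Fin 2 → ℝ) 1) : Fin 2 → ℝ) := by
      show (1 - ((0 : I) : ℝ)) • _ + ((0 : I) : ℝ) • _ = _
      simp
    have h : (⟨‖V (0, y)‖⁻¹ • V (0, y), inv_norm_smul_mem_unitClosedBall _⟩ : closedBall (0 : Fin 2 → ℝ) 1) =
        toBall 2 (collapse y) :=
      Subtype.ext (by show ‖V (0, y)‖⁻¹ • V (0, y) = _; rw [hV0, h1, inv_one, one_smul])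
    show (toBall 2).symm ⟨‖V (0, y)‖⁻¹ • V (0, y), inv_norm_smul_mem_unitClosedBall _⟩ = collapse y
    rw [h, Homeomorph.symm_apply_apply]
  have hK1 : ∀ y ∈ Cube.boundary (Fin 2), K (1, y) = cubeSimplexHomeo 2 y := by
    intro y hy
    have h1 : ‖cubeStretch 2 y‖ = 1 := (norm_cubeStretch_eq_one_iff y).2 hy
    have hV1 : V (1, y) = cubeStretch 2 y := by
      show (1 - ((1 : I) : ℝ)) • _ + ((1 : I) : ℝ) • _ = _
      simp
    have h : (⟨‖V (1, y)‖⁻¹ • V (1, y), inv_norm_smul_mem_unitClosedBall _⟩ : closedBall (0 : Fin 2 → ℝ) 1) =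
        ⟨cubeStretch 2 y, cubeStretch_mem_closedBall y⟩ :=
      Subtype.ext (by show ‖V (1, y)‖⁻¹ • V (1, y) = _; rw [hV1, h1, inv_one, one_smul])
    show (toBall 2).symm ⟨‖V (1, y)‖⁻¹ • V (1, y), inv_norm_smul_mem_unitClosedBall _⟩ = cubeSimplexHomeo 2 y
    rw [h, cubeSimplexHomeo_apply]
  -- homotopy extension over `I²`
  obtain ⟨Φ, hΦ0, hΦb⟩ := CubeHEP.exists_extension_cube (cubeCollapse 2) K hKc hK0
  -- the end `Φ₁` of the extension, which is `κ₂` on `∂I²`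
  let Φ₁ : C(Fin 2 → I, StdSimplex 2) := ⟨fun y => Φ (1, y), Φ.continuous.comp (by fun_prop)⟩
  have hΦ₁ : ∀ y ∈ Cube.boundary (Fin 2), Φ₁ y = cubeSimplexHomeo 2 y := fun y hy => by
    show Φ (1, y) = _
    rw [hΦb 1 y hy, hK1 y hy]
  let H₁ : (cubeCollapse 2).HomotopyWith Φ₁ (fun f => ∀ y ∈ Cube.boundary (Fin 2), f y ∈ stdBoundary 2) :=
    { toFun := Φ
      continuous_toFun := Φ.continuous
      map_zero_left := fun y => hΦ0 y
      map_one_left := fun y => rfl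
      prop' := fun t y hy => by
        show Φ (t, y) ∈ stdBoundary 2
        rw [hΦb t y hy]
        exact hKb t y hy }
  -- the straight segment to `κ₂`, rel `∂I²`
  let H₂ : Φ₁.HomotopyWith (cubeToSimplex 2) (fun f => ∀ y ∈ Cube.boundary (Fin 2), f y ∈ stdBoundary 2) :=
    { toFun := fun q => StdSimplex.segm q.1 (Φ₁ q.2) (cubeSimplexHomeo 2 q.2)
      continuous_toFun := StdSimplex.continuous_segm.comp (continuous_fst.prodMk
        ((Φ₁.continuous.comp continuous_snd).prodMk ((cubeSimplexHomeo 2).continuous.comp continuous_snd)))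
      map_zero_left := fun y => StdSimplex.segm_zero _ _
      map_one_left := fun y => StdSimplex.segm_one _ _
      prop' := fun t y hy => by
        show StdSimplex.segm t (Φ₁ y) (cubeSimplexHomeo 2 y) ∈ stdBoundary 2
        rw [hΦ₁ y hy, StdSimplex.segm_self]
        exact mapsTo_cubeSimplexHomeo_boundary hy }
  exact ⟨H₁.trans H₂⟩

/-! ### Equality of the two devices in degree `2` -/

variable {X : Type u} [TopologicalSpace X] {x₀ : X}

/-- **In degree `2` the collapse device and the radial device agree**: for a singular simplex
`g : (Δ², ∂Δ²) → (X, x₀)`, `[g ∘ c₂] = [g ∘ κ₂]` in `π₂(X, x₀)`, i.e.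
`collapseClass g hg = simplexClass g hg` (both being Spanier's `[g]`, 1981, Ch. 7 §4 p. 391, read
through two relative homeomorphisms `(I², ∂I²) → (Δ², ∂Δ²)` which are homotopic as maps of pairs).
[folklore] -/
theorem collapseClass_eq_simplexClass (g : C(StdSimplex 2, X)) (hg : ∀ t ∈ stdBoundary 2, g t = x₀) :
    collapseClass g hg = simplexClass g hg := by
  obtain ⟨Ψ⟩ := homotopicWith_collapse_cubeSimplexHomeo
  refine Quotient.sound ⟨{
    toFun := fun q => g (Ψ q)
    continuous_toFun := g.continuous.comp Ψ.continuous
    map_zero_left := fun y => by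
      show g (Ψ (0, y)) = g (collapse y)
      rw [Ψ.apply_zero]; rfl
    map_one_left := fun y => by
      show g (Ψ (1, y)) = g (cubeSimplexHomeo 2 y)
      rw [Ψ.apply_one]
      rfl
    prop' := fun t y hy => by
      have hmem : Ψ (t, y) ∈ stdBoundary 2 := Ψ.prop t y hy
      show g (Ψ (t, y)) = g (collapse y)
      rw [hg _ hmem, hg _ (collapse_mem_stdBoundary hy)] }⟩

end CollapseCompare

open CollapseCompare

variable {X : Type u} [TopologicalSpace X] {x₀ : X}

/-- **The homotopy addition theorem in degree `2` for the classes `simplexClass`** (Spanier 1981,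
Ch. 7 §5 Prop. 3, `B₂`, absolute form `∑ (-1)ⁱ [σ⁽ⁱ⁾] = 0` of part (d), p. 397): for `τ : Δ³ → X`
constant `= x₀` on the `1`-skeleton, `∏ᵢ [τ ∘ δᵢ]^((-1)ⁱ) = 1` in `π₂(X, x₀)`, the classes being
read through the radial homeomorphism `κ₂` — transported from `prod_collapseClass_face_zpow_eq_one`
along `collapseClass_eq_simplexClass`. [cite: Spanier1981, Ch. 7 §5 Prop. 3] -/
theorem prod_simplexClass_face_zpow_eq_one (τ : C(StdSimplex 3, X))
    (hτ : ∀ t ∈ stdSkel 3 1, τ t = x₀) :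
    ∏ i : Fin 4, simplexClass (τ.comp (stdFace i)) (comp_stdFace_apply_of_mem_stdSkel τ hτ i) ^
      ((-1 : ℤ) ^ (i : ℕ)) = 1 := by
  rw [← prod_collapseClass_face_zpow_eq_one (k := 0) τ hτ]
  exact Finset.prod_congr rfl fun i _ => by rw [collapseClass_eq_simplexClass]

/-- In a commutative group, `x₀ x₁⁻¹ x₂ x₃⁻¹ = 1` (as the alternating product over `Fin 4`) gives
`x₀ x₂ = x₁ x₃`. [folklore] -/
lemma mul_eq_mul_of_prod_zpow_neg_one_pow_eq_one {G : Type*} [CommGroup G] (x : Fin 4 → G)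
    (h : ∏ i : Fin 4, x i ^ ((-1 : ℤ) ^ (i : ℕ)) = 1) : x 0 * x 2 = x 1 * x 3 := by
  rw [Fin.prod_univ_four] at h
  simp only [Fin.val_zero, pow_zero, zpow_one, Fin.val_one, pow_one, Fin.val_two,
    show ((3 : Fin 4) : ℕ) = 3 from rfl] at h
  have e3 : ((-1 : ℤ) ^ 2) = 1 := by norm_num
  have e4 : ((-1 : ℤ) ^ 3) = -1 := by norm_num
  rw [e3, e4, zpow_one, zpow_neg, zpow_one, zpow_neg, zpow_one] at h
  -- `h : x 0 * (x 1)⁻¹ * x 2 * (x 3)⁻¹ = 1`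
  have h1 : x 0 * (x 1)⁻¹ * x 2 = x 3 := mul_inv_eq_one.1 h
  rw [mul_right_comm] at h1
  rw [mul_inv_eq_iff_eq_mul.1 h1, mul_comm]

/-- **`B₂` in product form**: for `τ : Δ³ → X` constant `= x₀` on the `1`-skeleton,
`[τ ∘ δ₀] · [τ ∘ δ₂] = [τ ∘ δ₁] · [τ ∘ δ₃]` in `π₂(X, x₀)` (classes `simplexClass`).
[cite: Spanier1981, Ch. 7 §5 Prop. 3] -/
theorem simplexClass_face_mul_eq (τ : C(StdSimplex 3, X)) (hτ : ∀ t ∈ stdSkel 3 1, τ t = x₀) :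
    simplexClass (τ.comp (stdFace 0)) (comp_stdFace_apply_of_mem_stdSkel τ hτ 0) *
        simplexClass (τ.comp (stdFace 2)) (comp_stdFace_apply_of_mem_stdSkel τ hτ 2) =
      simplexClass (τ.comp (stdFace 1)) (comp_stdFace_apply_of_mem_stdSkel τ hτ 1) *
        simplexClass (τ.comp (stdFace 3)) (comp_stdFace_apply_of_mem_stdSkel τ hτ 3) :=
  mul_eq_mul_of_prod_zpow_neg_one_pow_eq_one
    (fun i => simplexClass (τ.comp (stdFace i)) (comp_stdFace_apply_of_mem_stdSkel τ hτ i))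
    (prod_simplexClass_face_zpow_eq_one τ hτ)

end Literature.AlgebraicTopology.SingularHomology

end
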